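import Literature.NumberTheory.EllipticCurves.BhargavaSkinnerZhang2014.CellUnion
import Literature.NumberTheory.EllipticCurves.BhargavaSkinnerZhang2014.SelmerCounting
import HarnessLib

/-!
# Bhargava–Skinner–Zhang 2014, §3 bookkeeping (ii): one cell — from the converse theorems and the `p`-Selmer average to a lower density of `{BSD, rank ≤ 1}`

Source: M. Bhargava, C. Skinner, W. Zhang, *A majority of elliptic curves over `ℚ` satisfy the Birch and Swinnerton-Dyer
conjecture*, arXiv:1407.1826v2 (2014) [BhargavaSkinnerZhang2014], §3: Thm. 21 + Cor. 22 (rank `0`), Thm. 23 + Cor. 24 (rank `1`),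
Thm. 25 + Cor. 26 (both), with the inputs Thms. 15–16 (parity, root-number equidistribution in large families), Lemmas 17–20
(densities) and §2 (the cited converse theorems and the Selmer average).

Reproduction, ABSTRACT and PROVED: BSZ's §3 counting argument re-run over a record `Invariants` of bare functions on the height
family `(A, B) ↦ E_{A,B}` (Mordell–Weil rank, analytic rank, `p`-Selmer rank, root number, finiteness of `Ш`) — the cited
theorems enter ONLY as hypotheses about these functions, cell by cell, in exactly the form the counting consumes (`CellData`:
the cell `C`, its twist-stable equidistributed subfamily `U ⊆ C`, the good set `G` carrying Dokchitser–Dokchitser parity and the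
converse theorems, Gross–Zagier–Kolyvagin; `CellDensities`: `μ(C) ≥ μ`, `μ(U | C) ≥ κ`, `μ̄(C ∖ G) ≤ ν` in count form).  For
general `p ≥ 2` the file proves the finite-height counts `cell_both_count` / `cell_rank_zero_count` / `cell_rank_one_count` (BSZ's
linear programmes, `SelmerCounting`, fed by `half_sub_le_card_filter_parity`, `CellUnion`) and the three CELL THEOREMS: the lower
density of `{BSD rank conjecture with rank ≤ 1} ∩ C` is `≥ ((p²−p−1) + (p−1)κ/2)·μ/(p²−1) − (p+2)ν/(p+1)` with BOTH converses
(`heightDensityGE_cell_both`; `p = 5`: `(19/24 + κ/12)μ − 7ν/6`), `≥ (p−2)κμ/(2p−2) − 2ν` with the rank-`0` converse only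
(`heightDensityGE_cell_rank_zero`), `≥ (p²−p−1)κμ/(2p²−2p) − 2ν` with the rank-`1` converse only (`heightDensityGE_cell_rank_one`).
Dictionary to the tree (`Literature/NumberTheory/EllipticCurves/`): `rank = WeierstrassCurve.mordellWeilRank ∘ shortWeierstrass`,
`analyticRank = WeierstrassCurve.analyticRank ∘ shortWeierstrass`, `p ^ selmerRank p = Nat.card (selmerGroup · p)`,
`rootNumber = WeierstrassCurve.rootNumber ∘ shortWeierstrass`, `shaFinite = Finite (sha ·)`; then `BSDRankLeOne inv` is the
tree's `SatisfiesBSDRankLeOne` (`LeadingTerm.lean`).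

Relation to the tree: `LeadingTermBSZAssemblyProofs.lean` proves BSZ's ONE-cell, `p = 5`, both-converses assembly for the
concrete invariants; the present file is the abstract, general-`p`, three-variant cell engine that the `pub-bsdpct` bundle sums
over several disjoint cells (`CellUnion.heightDensityGE_of_cells`).  The rank-`0`-only and rank-`1`-only variants and the
explicit exceptional-density bookkeeping `ν` are that bundle's additions to BSZ §3 (its paper, §3); every line is elementary.
Origin: `BSDPercentage/Bookkeeping.lean` (sha256 3f8682f0…, run of record 72) of the `pub-bsdpct` bundle's staged package
(BirchSwinnertonDyer / bsd-percentage), namespace-rewritten `BSDPercentage → Literature.NumberTheory.EllipticCurves.BhargavaSkinnerZhang2014`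
(LEAN-IN-TREE rule, 2026-08-18) with the MODULE-MAP §2.1 dedup applied: the package's copies of lemmas ALREADY LANDED in
`Literature/NumberTheory/EllipticCurves/` (`heightProportion_eq_card_div`, `eventually_heightFamilyBelow_card_pos`,
`HeightDensityGE.eventually_mul_card_le`, `negB` and its five lemmas, `heightProportion_or_of_disjoint`) are dropped and the tree's
are used; every other statement and proof is byte-identical (the packager's manifest lists the one adapted proof line and the
one rename).  "BSZ" / "paper" / `Statement.lean` / `Headline.lean` in the docstrings refer to the cited source and to that bundle.

What is NOT here: the named, curve-theoretic forms of the hypotheses and the multi-cell theorem (the bundle's `Statement.lean`,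
Summit-side pending a placement ruling), the cells actually used and every numerical density or percentage (the bundle's
`Headline.lean` etc., Summit-side; density values in the `Densities` files), and any claim that the hypotheses hold — they are
binders.
-/

noncomputable section

open scoped Classical
open Filter Topology Finset

namespace Literature.NumberTheory.EllipticCurves.BhargavaSkinnerZhang2014

/-! ### Abstract invariants and the counted property -/

/-- The arithmetic invariants of the curves `E_{A,B}` that the bookkeeping consumes, as bare functions of
`(A, B)`: Mordell–Weil rank, analytic rank, `p`-Selmer rank `s_p` (so `#Sel_p(E) = p ^ s_p`), global root
number `w(E) ∈ {±1}`, and finiteness of `Ш(E/ℚ)`. [folklore] -/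
structure Invariants where
  /-- `rank_ℤ E_{A,B}(ℚ)` -/
  rank : ℤ × ℤ → ℕ
  /-- `ord_{s=1} L(E_{A,B}, s)` -/
  analyticRank : ℤ × ℤ → ℕ
  /-- `dim_{𝔽_p} Sel_p(E_{A,B})` -/
  selmerRank : ℕ → ℤ × ℤ → ℕ
  /-- the global root number `w(E_{A,B})` -/
  rootNumber : ℤ × ℤ → ℤ
  /-- `Ш(E_{A,B}/ℚ)` is finite -/
  shaFinite : ℤ × ℤ → Prop

/-- The counted property (the tree's `SatisfiesBSDRankLeOne`): `(A, B)` is in the height family,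
`rank E(ℚ) = ord_{s=1} L(E, s) ≤ 1`, and `Ш(E/ℚ)` is finite.
[cite: BhargavaSkinnerZhang2014, Thms 1–2] -/
def BSDRankLeOne (inv : Invariants) (AB : ℤ × ℤ) : Prop :=
  IsInHeightFamily AB ∧ inv.rank AB = inv.analyticRank AB ∧ inv.analyticRank AB ≤ 1 ∧ inv.shaFinite AB

/-! ### One cell: from the converse theorems and the Selmer average to a lower density -/

section Cells

variable (inv : Invariants) (p : ℕ)

/-- The cell hypotheses shared by the three cell theorems, bundled: `C` is the cell, `U ⊆ C` its
twist-stable subfamily with flipped root numbers (BSZ Thm 16), `G` the good set on which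
Dokchitser–Dokchitser parity holds with `E(ℚ)[p] = 0` (BSZ Thm 15, Lemma 20) and on which the converse
theorems for the cell apply; `analyticRank ≤ 1 ⇒ rank = analyticRank ∧ Ш finite` is Gross–Zagier–Kolyvagin.
[cite: BhargavaSkinnerZhang2014, §2–3] -/
structure CellData where
  /-- the cell (a large family) -/
  C : ℤ × ℤ → Prop
  /-- the equidistributed subfamily -/
  U : ℤ × ℤ → Prop
  /-- the good set (density-one conditions and side conditions of the converse theorems) -/
  G : ℤ × ℤ → Prop
  /-- `U ⊆ C` -/
  hUC : ∀ AB, U AB → C AB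
  /-- `U` is stable under `E_{A,B} ↦ E_{A,-B}` -/
  hU : ∀ AB, U AB → U (negB AB)
  /-- on `U` the root number flips under `E_{A,B} ↦ E_{A,-B}` (BSZ Thm 16) -/
  hflip : ∀ AB, U AB → inv.rootNumber (negB AB) = -inv.rootNumber AB
  /-- root numbers are `±1` -/
  hw : ∀ AB, inv.rootNumber AB = 1 ∨ inv.rootNumber AB = -1
  /-- on the good set, the parity of the `p`-Selmer rank is that of the root number (Dokchitser–Dokchitser + `E(ℚ)[p] = 0`, BSZ Thm 15) -/
  hDD : ∀ AB, IsInHeightFamily AB → G AB → (Even (inv.selmerRank p AB) ↔ inv.rootNumber AB = 1)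
  /-- Gross–Zagier–Kolyvagin: analytic rank `≤ 1` ⇒ rank `=` analytic rank and `Ш` finite -/
  hGZK : ∀ AB, IsInHeightFamily AB → inv.analyticRank AB ≤ 1 →
    inv.rank AB = inv.analyticRank AB ∧ inv.shaFinite AB

variable {inv p}

/-- Counting form of the "both converses" cell bound at a finite height `X` (BSZ Thm 25 + Cor 26 inside one
cell): with `Σ_{C_X} p^{s_p} ≤ (p+1+η)·#C_X`,
`(p²-1)·#{BSD, rank ≤ 1}∩C_X ≥ (p²-p-1-η)·#C_X + (p-1)(#U_X/2 - #E_X) - (p²-1)·#E_X`, `E = C ∖ G`.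
[cite: BhargavaSkinnerZhang2014, Thm 25, Cor 26 (proof)] -/
theorem cell_both_count (hp : 2 ≤ p) (d : CellData inv p)
    (hR0 : ∀ AB, IsInHeightFamily AB → d.C AB → d.G AB → inv.selmerRank p AB = 0 → inv.analyticRank AB = 0)
    (hR1 : ∀ AB, IsInHeightFamily AB → d.C AB → d.G AB → inv.selmerRank p AB = 1 → inv.analyticRank AB = 1)
    (X : ℕ) {η : ℝ}
    (h13 : ∑ AB ∈ (heightFamilyBelow X).filter d.C, (p : ℝ) ^ inv.selmerRank p AB
      ≤ (p + 1 + η) * ((heightFamilyBelow X).filter d.C).card) :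
    ((p : ℝ) ^ 2 - p - 1 - η) * ((heightFamilyBelow X).filter d.C).card
      + ((p : ℝ) - 1) * ((((heightFamilyBelow X).filter d.U).card : ℝ) / 2
          - ((heightFamilyBelow X).filter (fun AB ↦ d.C AB ∧ ¬ d.G AB)).card)
      - ((p : ℝ) ^ 2 - 1) * ((heightFamilyBelow X).filter (fun AB ↦ d.C AB ∧ ¬ d.G AB)).card
      ≤ ((p : ℝ) ^ 2 - 1) *
        ((heightFamilyBelow X).filter (fun AB ↦ BSDRankLeOne inv AB ∧ d.C AB)).card := by
  set CX := (heightFamilyBelow X).filter d.C with hCX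
  set UX := (heightFamilyBelow X).filter d.U with hUX
  set EX := (heightFamilyBelow X).filter (fun AB ↦ d.C AB ∧ ¬ d.G AB) with hEX
  have hUXCX : UX ⊆ CX := by
    intro AB h
    rw [hUX, Finset.mem_filter] at h
    rw [hCX, Finset.mem_filter]
    exact ⟨h.1, d.hUC AB h.2⟩
  have hpar := (half_sub_le_card_filter_parity inv.rootNumber d.hw (inv.selmerRank p) d.C d.U d.G d.hUC
    d.hU d.hflip d.hDD X).1
  rw [← hUX, ← hEX] at hpar
  have hLP := card_rank_le_one_ge hp CX UX (inv.selmerRank p) hUXCX h13 hpar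
  -- `{s_p ≤ 1} ∩ C_X ⊆ {BSD} ∪ E_X`
  have hsub : (CX.filter fun AB ↦ inv.selmerRank p AB ≤ 1).card
      ≤ ((heightFamilyBelow X).filter (fun AB ↦ BSDRankLeOne inv AB ∧ d.C AB)).card + EX.card := by
    calc (CX.filter fun AB ↦ inv.selmerRank p AB ≤ 1).card
        ≤ (((heightFamilyBelow X).filter (fun AB ↦ BSDRankLeOne inv AB ∧ d.C AB)) ∪ EX).card := by
          refine Finset.card_le_card fun AB h ↦ ?_
          rw [Finset.mem_filter, hCX, Finset.mem_filter, mem_heightFamilyBelow_iff] at h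
          obtain ⟨⟨hmem, hC⟩, hle⟩ := h
          have hm : AB ∈ heightFamilyBelow X := (mem_heightFamilyBelow_iff _ _).mpr hmem
          rw [Finset.mem_union]
          by_cases hG : d.G AB
          · left
            refine Finset.mem_filter.mpr ⟨hm, ⟨hmem.1, ?_⟩, hC⟩
            have han : inv.analyticRank AB ≤ 1 := by
              rcases Nat.le_one_iff_eq_zero_or_eq_one.mp hle with h0 | h1
              · rw [hR0 AB hmem.1 hC hG h0]; norm_num
              · rw [hR1 AB hmem.1 hC hG h1]
            exact ⟨(d.hGZK AB hmem.1 han).1, han, (d.hGZK AB hmem.1 han).2⟩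
          · right
            rw [hEX]
            exact Finset.mem_filter.mpr ⟨hm, hC, hG⟩
      _ ≤ _ := Finset.card_union_le _ _
  have hsubR : ((CX.filter fun AB ↦ inv.selmerRank p AB ≤ 1).card : ℝ)
      ≤ ((heightFamilyBelow X).filter (fun AB ↦ BSDRankLeOne inv AB ∧ d.C AB)).card + EX.card := by
    exact_mod_cast hsub
  have hp2 : (2 : ℝ) ≤ p := by exact_mod_cast hp
  have hp21 : 0 ≤ (p : ℝ) ^ 2 - 1 := by nlinarith
  nlinarith [mul_le_mul_of_nonneg_left hsubR hp21]

/-- Counting form of the rank-`0`-only cell bound (BSZ Thm 21 + Cor 22 inside one cell), with the Selmer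
average taken over `U`: `(p²-1)·#{BSD}∩C_X ≥ ((p²-p-2)/2 - η)·#U_X - (p²+p-2)·#E_X - (p²-1)·#E_X`.
[cite: BhargavaSkinnerZhang2014, Thm 21, Cor 22] -/
theorem cell_rank_zero_count (hp : 2 ≤ p) (d : CellData inv p)
    (hR0 : ∀ AB, IsInHeightFamily AB → d.C AB → d.G AB → inv.selmerRank p AB = 0 → inv.analyticRank AB = 0)
    (X : ℕ) {η : ℝ}
    (h13 : ∑ AB ∈ (heightFamilyBelow X).filter d.U, (p : ℝ) ^ inv.selmerRank p AB
      ≤ (p + 1 + η) * ((heightFamilyBelow X).filter d.U).card) :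
    (((p : ℝ) ^ 2 - p - 2) / 2 - η) * ((heightFamilyBelow X).filter d.U).card
      - ((p : ℝ) ^ 2 + p - 2) * ((heightFamilyBelow X).filter (fun AB ↦ d.C AB ∧ ¬ d.G AB)).card
      - ((p : ℝ) ^ 2 - 1) * ((heightFamilyBelow X).filter (fun AB ↦ d.C AB ∧ ¬ d.G AB)).card
      ≤ ((p : ℝ) ^ 2 - 1) *
        ((heightFamilyBelow X).filter (fun AB ↦ BSDRankLeOne inv AB ∧ d.C AB)).card := by
  set UX := (heightFamilyBelow X).filter d.U with hUX
  set EX := (heightFamilyBelow X).filter (fun AB ↦ d.C AB ∧ ¬ d.G AB) with hEX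
  have hpar := half_sub_le_card_filter_parity inv.rootNumber d.hw (inv.selmerRank p) d.C d.U d.G d.hUC
    d.hU d.hflip d.hDD X
  rw [← hUX, ← hEX] at hpar
  have hLP := card_rank_zero_ge hp UX (inv.selmerRank p) h13 hpar.1 hpar.2
  have hsub : (UX.filter fun AB ↦ inv.selmerRank p AB = 0).card
      ≤ ((heightFamilyBelow X).filter (fun AB ↦ BSDRankLeOne inv AB ∧ d.C AB)).card + EX.card := by
    calc (UX.filter fun AB ↦ inv.selmerRank p AB = 0).card
        ≤ (((heightFamilyBelow X).filter (fun AB ↦ BSDRankLeOne inv AB ∧ d.C AB)) ∪ EX).card := by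
          refine Finset.card_le_card fun AB h ↦ ?_
          rw [Finset.mem_filter, hUX, Finset.mem_filter, mem_heightFamilyBelow_iff] at h
          obtain ⟨⟨hmem, hU⟩, h0⟩ := h
          have hC := d.hUC AB hU
          have hm : AB ∈ heightFamilyBelow X := (mem_heightFamilyBelow_iff _ _).mpr hmem
          rw [Finset.mem_union]
          by_cases hG : d.G AB
          · left
            refine Finset.mem_filter.mpr ⟨hm, ⟨hmem.1, ?_⟩, hC⟩
            have han : inv.analyticRank AB ≤ 1 := by rw [hR0 AB hmem.1 hC hG h0]; norm_num
            exact ⟨(d.hGZK AB hmem.1 han).1, han, (d.hGZK AB hmem.1 han).2⟩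
          · right
            rw [hEX]
            exact Finset.mem_filter.mpr ⟨hm, hC, hG⟩
      _ ≤ _ := Finset.card_union_le _ _
  have hsubR : ((UX.filter fun AB ↦ inv.selmerRank p AB = 0).card : ℝ)
      ≤ ((heightFamilyBelow X).filter (fun AB ↦ BSDRankLeOne inv AB ∧ d.C AB)).card + EX.card := by
    exact_mod_cast hsub
  have hp2 : (2 : ℝ) ≤ p := by exact_mod_cast hp
  have hp21 : 0 ≤ (p : ℝ) ^ 2 - 1 := by nlinarith
  nlinarith [mul_le_mul_of_nonneg_left hsubR hp21]

/-- Counting form of the rank-`1`-only cell bound (BSZ Thm 23 + Cor 24 inside one cell), with the Selmer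
average taken over `U`: `(p³-p)·#{BSD}∩C_X ≥ ((p³-1)/2 - p - η)·#U_X - (p³-1)·#E_X - (p³-p)·#E_X`.
[cite: BhargavaSkinnerZhang2014, Thm 23, Cor 24] -/
theorem cell_rank_one_count (hp : 2 ≤ p) (d : CellData inv p)
    (hR1 : ∀ AB, IsInHeightFamily AB → d.C AB → d.G AB → inv.selmerRank p AB = 1 → inv.analyticRank AB = 1)
    (X : ℕ) {η : ℝ}
    (h13 : ∑ AB ∈ (heightFamilyBelow X).filter d.U, (p : ℝ) ^ inv.selmerRank p AB
      ≤ (p + 1 + η) * ((heightFamilyBelow X).filter d.U).card) :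
    (((p : ℝ) ^ 3 - 1) / 2 - p - η) * ((heightFamilyBelow X).filter d.U).card
      - ((p : ℝ) ^ 3 - 1) * ((heightFamilyBelow X).filter (fun AB ↦ d.C AB ∧ ¬ d.G AB)).card
      - ((p : ℝ) ^ 3 - p) * ((heightFamilyBelow X).filter (fun AB ↦ d.C AB ∧ ¬ d.G AB)).card
      ≤ ((p : ℝ) ^ 3 - p) *
        ((heightFamilyBelow X).filter (fun AB ↦ BSDRankLeOne inv AB ∧ d.C AB)).card := by
  set UX := (heightFamilyBelow X).filter d.U with hUX
  set EX := (heightFamilyBelow X).filter (fun AB ↦ d.C AB ∧ ¬ d.G AB) with hEX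
  have hpar := half_sub_le_card_filter_parity inv.rootNumber d.hw (inv.selmerRank p) d.C d.U d.G d.hUC
    d.hU d.hflip d.hDD X
  rw [← hUX, ← hEX] at hpar
  have hLP := card_rank_one_ge hp UX (inv.selmerRank p) h13 hpar.1
  have hsub : (UX.filter fun AB ↦ inv.selmerRank p AB = 1).card
      ≤ ((heightFamilyBelow X).filter (fun AB ↦ BSDRankLeOne inv AB ∧ d.C AB)).card + EX.card := by
    calc (UX.filter fun AB ↦ inv.selmerRank p AB = 1).card
        ≤ (((heightFamilyBelow X).filter (fun AB ↦ BSDRankLeOne inv AB ∧ d.C AB)) ∪ EX).card := by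
          refine Finset.card_le_card fun AB h ↦ ?_
          rw [Finset.mem_filter, hUX, Finset.mem_filter, mem_heightFamilyBelow_iff] at h
          obtain ⟨⟨hmem, hU⟩, h1⟩ := h
          have hC := d.hUC AB hU
          have hm : AB ∈ heightFamilyBelow X := (mem_heightFamilyBelow_iff _ _).mpr hmem
          rw [Finset.mem_union]
          by_cases hG : d.G AB
          · left
            refine Finset.mem_filter.mpr ⟨hm, ⟨hmem.1, ?_⟩, hC⟩
            have han : inv.analyticRank AB ≤ 1 := by rw [hR1 AB hmem.1 hC hG h1]
            exact ⟨(d.hGZK AB hmem.1 han).1, han, (d.hGZK AB hmem.1 han).2⟩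
          · right
            rw [hEX]
            exact Finset.mem_filter.mpr ⟨hm, hC, hG⟩
      _ ≤ _ := Finset.card_union_le _ _
  have hsubR : ((UX.filter fun AB ↦ inv.selmerRank p AB = 1).card : ℝ)
      ≤ ((heightFamilyBelow X).filter (fun AB ↦ BSDRankLeOne inv AB ∧ d.C AB)).card + EX.card := by
    exact_mod_cast hsub
  have hp2 : (2 : ℝ) ≤ p := by exact_mod_cast hp
  have hp31 : 0 ≤ (p : ℝ) ^ 3 - p := by
    have e : (p : ℝ) ^ 3 - p = p * (p ^ 2 - 1) := by ring
    rw [e]; exact mul_nonneg (by linarith) (by nlinarith)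
  nlinarith [mul_le_mul_of_nonneg_left hsubR hp31]

/-- Density hypotheses of a cell: `C` has lower density `≥ μ`, `U` has relative lower density `≥ κ` in `C`,
and the exceptional set `C ∖ G` has upper density `≤ ν`, all in the finite-height "count" form.
[cite: BhargavaSkinnerZhang2014, Lemmas 17–20, Thm 16, (mu-diff)] -/
structure CellDensities (d : CellData inv p) (μ κ ν : ℝ) : Prop where
  /-- `C` has lower density `≥ μ` (count form) -/
  hC : ∀ η : ℝ, 0 < η → ∀ᶠ X : ℕ in atTop,
    (μ - η) * (heightFamilyBelow X).card ≤ ((heightFamilyBelow X).filter d.C).card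
  /-- `U` has relative lower density `≥ κ` in `C` (count form) -/
  hκ : ∀ η : ℝ, 0 < η → ∀ᶠ X : ℕ in atTop,
    (κ - η) * ((heightFamilyBelow X).filter d.C).card ≤ ((heightFamilyBelow X).filter d.U).card
  /-- the exceptional set `C ∖ G` has upper density `≤ ν` (count form) -/
  hν : ∀ η : ℝ, 0 < η → ∀ᶠ X : ℕ in atTop,
    (((heightFamilyBelow X).filter (fun AB ↦ d.C AB ∧ ¬ d.G AB)).card : ℝ)
      ≤ (ν + η) * (heightFamilyBelow X).card
  /-- `μ ≤ 1` -/
  hμ1 : μ ≤ 1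
  /-- `0 ≤ κ` -/
  hκ0 : 0 ≤ κ
  /-- `κ ≤ 1` -/
  hκ1 : κ ≤ 1
  /-- `0 ≤ ν` -/
  hν0 : 0 ≤ ν

/-- A technical limit step: if `g` is continuous at `0`, then for every `b > 0` some `θ ∈ (0, b]` has
`g 0 - ε < g θ`. [folklore] -/
theorem exists_small_param {g : ℝ → ℝ} (hg : ContinuousAt g 0) {ε : ℝ} (hε : 0 < ε) {b : ℝ}
    (hb : 0 < b) : ∃ θ : ℝ, 0 < θ ∧ θ ≤ b ∧ g 0 - ε < g θ := by
  have h1 : ∀ᶠ θ in 𝓝 (0 : ℝ), g 0 - ε < g θ :=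
    hg.eventually (Ioi_mem_nhds (by linarith))
  have h2 : ∀ᶠ θ in 𝓝[>] (0 : ℝ), 0 < θ := eventually_nhdsWithin_of_forall fun θ hθ ↦ hθ
  have h3 : ∀ᶠ θ in 𝓝[>] (0 : ℝ), θ ≤ b := nhdsWithin_le_nhds (Iic_mem_nhds hb)
  obtain ⟨θ, hθ1, hθ2, hθ3⟩ := ((h1.filter_mono nhdsWithin_le_nhds).and (h2.and h3)).exists
  exact ⟨θ, hθ2, hθ3, hθ1⟩

/-- A nonpositive lower density bound is automatic. [folklore] -/
theorem heightDensityGE_of_nonpos {P : ℤ × ℤ → Prop} {δ : ℝ} (hδ : δ ≤ 0) : HeightDensityGE P δ :=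
  fun ε hε ↦ Eventually.of_forall fun X ↦ by linarith [heightProportion_nonneg P X]

/-- **Cell theorem, both converses** (BSZ Thm 25 + Cor 26 inside one cell, general `p`). If the `p`-Selmer
average over the cell `C` is `≤ p + 1`, both converse theorems hold on `C ∩ G`, and the densities are as in
`CellDensities d μ κ ν`, then at least a proportion
`((p²-p-1 + (p-1)κ/2)·μ - (p²+p-2)·ν)/(p²-1)` of all curves lie in `C` and satisfy the BSD rank
conjecture with rank `≤ 1` (for `p = 5`: `(19/24 + κ/12)μ - 7ν/6`; for `p = 3`: `(5/8 + κ/8)μ - 5ν/4`).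
[cite: BhargavaSkinnerZhang2014, Thm 25, Cor 26] -/
theorem heightDensityGE_cell_both (hp : 2 ≤ p) (d : CellData inv p) {μ κ ν : ℝ}
    (hd : CellDensities d μ κ ν)
    (h13 : ∀ η : ℝ, 0 < η → ∀ᶠ X : ℕ in atTop,
      ∑ AB ∈ (heightFamilyBelow X).filter d.C, (p : ℝ) ^ inv.selmerRank p AB
        ≤ (p + 1 + η) * ((heightFamilyBelow X).filter d.C).card)
    (hR0 : ∀ AB, IsInHeightFamily AB → d.C AB → d.G AB → inv.selmerRank p AB = 0 → inv.analyticRank AB = 0)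
    (hR1 : ∀ AB, IsInHeightFamily AB → d.C AB → d.G AB → inv.selmerRank p AB = 1 → inv.analyticRank AB = 1)
    {δ : ℝ} (hδ : δ ≤ ((((p : ℝ) ^ 2 - p - 1) + ((p : ℝ) - 1) * κ / 2) * μ - ((p : ℝ) ^ 2 + p - 2) * ν)
      / ((p : ℝ) ^ 2 - 1)) :
    HeightDensityGE (fun AB ↦ BSDRankLeOne inv AB ∧ d.C AB) δ := by
  have hp2 : (2 : ℝ) ≤ p := by exact_mod_cast hp
  have hsq : 0 ≤ ((p : ℝ) - 2) * ((p : ℝ) - 2) := mul_self_nonneg _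
  have hq : 0 < (p : ℝ) ^ 2 - 1 := by nlinarith
  have hc' : 0 ≤ (p : ℝ) ^ 2 + p - 2 := by nlinarith
  apply heightDensityGE_of_eventually_mul_card_le
  intro ε hε
  -- the bound as a continuous function of the slack `θ`
  let g : ℝ → ℝ := fun θ ↦ ((((p : ℝ) ^ 2 - p - 1 - θ) + ((p : ℝ) - 1) * (κ - θ) / 2) * (μ - θ)
    - ((p : ℝ) ^ 2 + p - 2) * (ν + θ)) / ((p : ℝ) ^ 2 - 1)
  have hg : ContinuousAt g 0 := by
    apply Continuous.continuousAt
    unfold g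
    fun_prop
  have hg0 : δ ≤ g 0 := by
    have e : g 0 = ((((p : ℝ) ^ 2 - p - 1) + ((p : ℝ) - 1) * κ / 2) * μ - ((p : ℝ) ^ 2 + p - 2) * ν)
        / ((p : ℝ) ^ 2 - 1) := by
      simp only [g, sub_zero, add_zero]
    rw [e]; exact hδ
  obtain ⟨θ, hθ, hθ2, hθg⟩ := exists_small_param hg hε (by norm_num : (0 : ℝ) < 1 / 2)
  filter_upwards [h13 θ hθ, hd.hC θ hθ, hd.hκ θ hθ, hd.hν θ hθ] with X h1 h2 h3 h4
  have hcnt := cell_both_count hp d hR0 hR1 X h1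
  set N : ℝ := (((heightFamilyBelow X).card : ℕ) : ℝ)
  set NC : ℝ := ((((heightFamilyBelow X).filter d.C).card : ℕ) : ℝ)
  set NU : ℝ := ((((heightFamilyBelow X).filter d.U).card : ℕ) : ℝ)
  set NE : ℝ := ((((heightFamilyBelow X).filter (fun AB ↦ d.C AB ∧ ¬ d.G AB)).card : ℕ) : ℝ)
  set B : ℝ := ((((heightFamilyBelow X).filter (fun AB ↦ BSDRankLeOne inv AB ∧ d.C AB)).card : ℕ) : ℝ)
  have hN : 0 ≤ N := Nat.cast_nonneg _
  -- the leading coefficient is nonnegative for `θ ≤ 1/2`, `κ ≥ 0`, `p ≥ 2`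
  have hc₁ : 0 ≤ ((p : ℝ) ^ 2 - p - 1 - θ) + ((p : ℝ) - 1) * (κ - θ) / 2 := by
    have h1 : 0 ≤ ((p : ℝ) - 1) * (κ - θ + 1 / 2) := mul_nonneg (by linarith) (by linarith [hd.hκ0])
    nlinarith [h1, hsq, hd.hκ0]
  have e1 : ((p : ℝ) - 1) * (((κ - θ) * NC) / 2) ≤ ((p : ℝ) - 1) * (NU / 2) :=
    mul_le_mul_of_nonneg_left (by linarith) (by linarith)
  have e2 : (((p : ℝ) ^ 2 - p - 1 - θ) + ((p : ℝ) - 1) * (κ - θ) / 2) * ((μ - θ) * N)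
      ≤ (((p : ℝ) ^ 2 - p - 1 - θ) + ((p : ℝ) - 1) * (κ - θ) / 2) * NC :=
    mul_le_mul_of_nonneg_left h2 hc₁
  have e3 : ((p : ℝ) ^ 2 + p - 2) * NE ≤ ((p : ℝ) ^ 2 + p - 2) * ((ν + θ) * N) :=
    mul_le_mul_of_nonneg_left h4 hc'
  have hmain : ((p : ℝ) ^ 2 - 1) * (g θ * N) ≤ ((p : ℝ) ^ 2 - 1) * B := by
    have eg : ((p : ℝ) ^ 2 - 1) * (g θ * N) = ((((p : ℝ) ^ 2 - p - 1 - θ) + ((p : ℝ) - 1) * (κ - θ) / 2)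
        * (μ - θ) - ((p : ℝ) ^ 2 + p - 2) * (ν + θ)) * N := by
      simp only [g]
      rw [div_mul_eq_mul_div, mul_div_assoc', mul_div_cancel_left₀ _ hq.ne']
    rw [eg]
    calc ((((p : ℝ) ^ 2 - p - 1 - θ) + ((p : ℝ) - 1) * (κ - θ) / 2) * (μ - θ)
            - ((p : ℝ) ^ 2 + p - 2) * (ν + θ)) * N
        = (((p : ℝ) ^ 2 - p - 1 - θ) + ((p : ℝ) - 1) * (κ - θ) / 2) * ((μ - θ) * N)
            - ((p : ℝ) ^ 2 + p - 2) * ((ν + θ) * N) := by ring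
      _ ≤ (((p : ℝ) ^ 2 - p - 1 - θ) + ((p : ℝ) - 1) * (κ - θ) / 2) * NC
            - ((p : ℝ) ^ 2 + p - 2) * NE := by linarith [e2, e3]
      _ = ((p : ℝ) ^ 2 - p - 1 - θ) * NC + ((p : ℝ) - 1) * (((κ - θ) * NC) / 2)
            - ((p : ℝ) - 1) * NE - ((p : ℝ) ^ 2 - 1) * NE := by ring
      _ ≤ ((p : ℝ) ^ 2 - p - 1 - θ) * NC + ((p : ℝ) - 1) * (NU / 2)
            - ((p : ℝ) - 1) * NE - ((p : ℝ) ^ 2 - 1) * NE := by linarith [e1]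
      _ = ((p : ℝ) ^ 2 - p - 1 - θ) * NC + ((p : ℝ) - 1) * (NU / 2 - NE)
            - ((p : ℝ) ^ 2 - 1) * NE := by ring
      _ ≤ ((p : ℝ) ^ 2 - 1) * B := hcnt
  have hB : g θ * N ≤ B := le_of_mul_le_mul_left hmain hq
  have : (δ - ε) * N ≤ g θ * N := mul_le_mul_of_nonneg_right (by linarith) hN
  linarith

/-- **Cell theorem, rank-`0` converse only** (BSZ Thm 21 + Cor 22 inside one cell, general `p`), with the
Selmer average over `U`: lower density `≥ ((p²-p-2)κμ/2 - (2p²+p-3)ν)/(p²-1)`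
(`p = 5`: `3κμ/8 - 13ν/6`). [cite: BhargavaSkinnerZhang2014, Thm 21, Cor 22] -/
theorem heightDensityGE_cell_rank_zero (hp : 2 ≤ p) (d : CellData inv p) {μ κ ν : ℝ}
    (hd : CellDensities d μ κ ν)
    (h13 : ∀ η : ℝ, 0 < η → ∀ᶠ X : ℕ in atTop,
      ∑ AB ∈ (heightFamilyBelow X).filter d.U, (p : ℝ) ^ inv.selmerRank p AB
        ≤ (p + 1 + η) * ((heightFamilyBelow X).filter d.U).card)
    (hR0 : ∀ AB, IsInHeightFamily AB → d.C AB → d.G AB → inv.selmerRank p AB = 0 → inv.analyticRank AB = 0)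
    (_hμ0 : 0 ≤ μ)
    {δ : ℝ} (hδ : δ ≤ ((((p : ℝ) ^ 2 - p - 2) / 2) * κ * μ - (2 * (p : ℝ) ^ 2 + p - 3) * ν)
      / ((p : ℝ) ^ 2 - 1)) :
    HeightDensityGE (fun AB ↦ BSDRankLeOne inv AB ∧ d.C AB) δ := by
  have hp2 : (2 : ℝ) ≤ p := by exact_mod_cast hp
  have hsq : 0 ≤ ((p : ℝ) - 2) * ((p : ℝ) - 2) := mul_self_nonneg _
  have hsq4 : (4 : ℝ) ≤ (p : ℝ) ^ 2 := by nlinarith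
  have hcube : 4 * (p : ℝ) ≤ (p : ℝ) ^ 3 := by
    nlinarith [mul_le_mul_of_nonneg_left hsq4 (by linarith : (0 : ℝ) ≤ p)]
  have hq : 0 < (p : ℝ) ^ 2 - 1 := by nlinarith
  have hc : 0 ≤ ((p : ℝ) ^ 2 - p - 2) / 2 := by nlinarith
  have hc' : 0 ≤ 2 * (p : ℝ) ^ 2 + p - 3 := by nlinarith
  by_cases hpos : 0 < ((p : ℝ) ^ 2 - p - 2) / 2 ∧ 0 < κ
  swap
  · -- degenerate case: the main term vanishes and the bound is `≤ 0`
    have hck : (((p : ℝ) ^ 2 - p - 2) / 2) * κ = 0 := by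
      rcases not_and_or.mp hpos with h | h
      · rw [le_antisymm (not_lt.mp h) hc, zero_mul]
      · rw [le_antisymm (not_lt.mp h) hd.hκ0, mul_zero]
    apply heightDensityGE_of_nonpos
    refine le_trans hδ ?_
    have hnum : (((p : ℝ) ^ 2 - p - 2) / 2) * κ * μ - (2 * (p : ℝ) ^ 2 + p - 3) * ν ≤ 0 := by
      rw [hck, zero_mul]
      nlinarith [mul_nonneg hc' hd.hν0]
    have := div_le_div_of_nonneg_right hnum hq.le
    rwa [zero_div] at this
  obtain ⟨hcpos, hκpos⟩ := hpos
  apply heightDensityGE_of_eventually_mul_card_le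
  intro ε hε
  let g : ℝ → ℝ := fun θ ↦ (((((p : ℝ) ^ 2 - p - 2) / 2) - θ) * ((κ - θ) * (μ - θ)) - (2 * (p : ℝ) ^ 2 + p - 3) * (ν + θ)) / ((p : ℝ) ^ 2 - 1)
  have hg : ContinuousAt g 0 := by
    apply Continuous.continuousAt
    unfold g
    fun_prop
  have hg0 : δ ≤ g 0 := by
    have e : g 0 = ((((p : ℝ) ^ 2 - p - 2) / 2) * κ * μ - (2 * (p : ℝ) ^ 2 + p - 3) * ν) / ((p : ℝ) ^ 2 - 1) := by
      simp only [g, sub_zero, add_zero, mul_assoc]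
    rw [e]; exact hδ
  have hb : 0 < min (min (1 / 2 : ℝ) (κ / 2)) ((((p : ℝ) ^ 2 - p - 2) / 2) / 2) :=
    lt_min (lt_min (by norm_num) (by linarith)) (by linarith)
  obtain ⟨θ, hθ, hθb, hθg⟩ := exists_small_param hg hε hb
  have hθ2 : θ ≤ 1 / 2 := le_trans hθb (le_trans (min_le_left _ _) (min_le_left _ _))
  have hθk : θ ≤ κ / 2 := le_trans hθb (le_trans (min_le_left _ _) (min_le_right _ _))
  have hθc : θ ≤ (((p : ℝ) ^ 2 - p - 2) / 2) / 2 := le_trans hθb (min_le_right _ _)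
  have hk : 0 ≤ κ - θ := by linarith
  have hc₀ : 0 ≤ (((p : ℝ) ^ 2 - p - 2) / 2) - θ := by linarith
  filter_upwards [h13 θ hθ, hd.hC θ hθ, hd.hκ θ hθ, hd.hν θ hθ] with X h1 h2 h3 h4
  have hcnt := cell_rank_zero_count hp d hR0 X h1
  set N : ℝ := (((heightFamilyBelow X).card : ℕ) : ℝ)
  set NC : ℝ := ((((heightFamilyBelow X).filter d.C).card : ℕ) : ℝ)
  set NU : ℝ := ((((heightFamilyBelow X).filter d.U).card : ℕ) : ℝ)
  set NE : ℝ := ((((heightFamilyBelow X).filter (fun AB ↦ d.C AB ∧ ¬ d.G AB)).card : ℕ) : ℝ)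
  set B : ℝ := ((((heightFamilyBelow X).filter (fun AB ↦ BSDRankLeOne inv AB ∧ d.C AB)).card : ℕ) : ℝ)
  have hN : 0 ≤ N := Nat.cast_nonneg _
  have eU : (κ - θ) * ((μ - θ) * N) ≤ NU := le_trans (mul_le_mul_of_nonneg_left h2 hk) h3
  have e1 : ((((p : ℝ) ^ 2 - p - 2) / 2) - θ) * ((κ - θ) * ((μ - θ) * N)) ≤ ((((p : ℝ) ^ 2 - p - 2) / 2) - θ) * NU :=
    mul_le_mul_of_nonneg_left eU hc₀
  have e3 : (2 * (p : ℝ) ^ 2 + p - 3) * NE ≤ (2 * (p : ℝ) ^ 2 + p - 3) * ((ν + θ) * N) := mul_le_mul_of_nonneg_left h4 hc'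
  have hmain : ((p : ℝ) ^ 2 - 1) * (g θ * N) ≤ ((p : ℝ) ^ 2 - 1) * B := by
    have eg : ((p : ℝ) ^ 2 - 1) * (g θ * N)
        = ((((((p : ℝ) ^ 2 - p - 2) / 2) - θ) * ((κ - θ) * (μ - θ)) - (2 * (p : ℝ) ^ 2 + p - 3) * (ν + θ))) * N := by
      simp only [g]
      rw [div_mul_eq_mul_div, mul_div_assoc', mul_div_cancel_left₀ _ hq.ne']
    rw [eg]
    calc ((((((p : ℝ) ^ 2 - p - 2) / 2) - θ) * ((κ - θ) * (μ - θ)) - (2 * (p : ℝ) ^ 2 + p - 3) * (ν + θ))) * N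
        = ((((p : ℝ) ^ 2 - p - 2) / 2) - θ) * ((κ - θ) * ((μ - θ) * N)) - (2 * (p : ℝ) ^ 2 + p - 3) * ((ν + θ) * N) := by ring
      _ ≤ ((((p : ℝ) ^ 2 - p - 2) / 2) - θ) * NU - (2 * (p : ℝ) ^ 2 + p - 3) * NE := by linarith [e1, e3]
      _ = ((((p : ℝ) ^ 2 - p - 2) / 2) - θ) * NU - ((p : ℝ) ^ 2 + p - 2) * NE - ((p : ℝ) ^ 2 - 1) * NE := by ring
      _ ≤ ((p : ℝ) ^ 2 - 1) * B := hcnt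
  have hB : g θ * N ≤ B := le_of_mul_le_mul_left hmain hq
  have : (δ - ε) * N ≤ g θ * N := mul_le_mul_of_nonneg_right (by linarith) hN
  linarith

/-- **Cell theorem, rank-`1` converse only** (BSZ Thm 23 + Cor 24 inside one cell, general `p`), with the
Selmer average over `U`: lower density `≥ (((p³-1)/2 - p)κμ - (2p³-p-1)ν)/(p³-p)`
(`p = 5`: `19κμ/40 - 41ν/20`). [cite: BhargavaSkinnerZhang2014, Thm 23, Cor 24] -/
theorem heightDensityGE_cell_rank_one (hp : 2 ≤ p) (d : CellData inv p) {μ κ ν : ℝ}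
    (hd : CellDensities d μ κ ν)
    (h13 : ∀ η : ℝ, 0 < η → ∀ᶠ X : ℕ in atTop,
      ∑ AB ∈ (heightFamilyBelow X).filter d.U, (p : ℝ) ^ inv.selmerRank p AB
        ≤ (p + 1 + η) * ((heightFamilyBelow X).filter d.U).card)
    (hR1 : ∀ AB, IsInHeightFamily AB → d.C AB → d.G AB → inv.selmerRank p AB = 1 → inv.analyticRank AB = 1)
    (_hμ0 : 0 ≤ μ)
    {δ : ℝ} (hδ : δ ≤ ((((p : ℝ) ^ 3 - 1) / 2 - p) * κ * μ - (2 * (p : ℝ) ^ 3 - p - 1) * ν)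
      / ((p : ℝ) ^ 3 - p)) :
    HeightDensityGE (fun AB ↦ BSDRankLeOne inv AB ∧ d.C AB) δ := by
  have hp2 : (2 : ℝ) ≤ p := by exact_mod_cast hp
  have hsq : 0 ≤ ((p : ℝ) - 2) * ((p : ℝ) - 2) := mul_self_nonneg _
  have hsq4 : (4 : ℝ) ≤ (p : ℝ) ^ 2 := by nlinarith
  have hcube : 4 * (p : ℝ) ≤ (p : ℝ) ^ 3 := by
    nlinarith [mul_le_mul_of_nonneg_left hsq4 (by linarith : (0 : ℝ) ≤ p)]
  have hq : 0 < (p : ℝ) ^ 3 - p := by nlinarith [hcube]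
  have hc : 0 ≤ ((p : ℝ) ^ 3 - 1) / 2 - p := by linarith [hcube]
  have hc' : 0 ≤ 2 * (p : ℝ) ^ 3 - p - 1 := by nlinarith
  by_cases hpos : 0 < ((p : ℝ) ^ 3 - 1) / 2 - p ∧ 0 < κ
  swap
  · -- degenerate case: the main term vanishes and the bound is `≤ 0`
    have hck : (((p : ℝ) ^ 3 - 1) / 2 - p) * κ = 0 := by
      rcases not_and_or.mp hpos with h | h
      · rw [le_antisymm (not_lt.mp h) hc, zero_mul]
      · rw [le_antisymm (not_lt.mp h) hd.hκ0, mul_zero]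
    apply heightDensityGE_of_nonpos
    refine le_trans hδ ?_
    have hnum : (((p : ℝ) ^ 3 - 1) / 2 - p) * κ * μ - (2 * (p : ℝ) ^ 3 - p - 1) * ν ≤ 0 := by
      rw [hck, zero_mul]
      nlinarith [mul_nonneg hc' hd.hν0]
    have := div_le_div_of_nonneg_right hnum hq.le
    rwa [zero_div] at this
  obtain ⟨hcpos, hκpos⟩ := hpos
  apply heightDensityGE_of_eventually_mul_card_le
  intro ε hε
  let g : ℝ → ℝ := fun θ ↦ (((((p : ℝ) ^ 3 - 1) / 2 - p) - θ) * ((κ - θ) * (μ - θ)) - (2 * (p : ℝ) ^ 3 - p - 1) * (ν + θ)) / ((p : ℝ) ^ 3 - p)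
  have hg : ContinuousAt g 0 := by
    apply Continuous.continuousAt
    unfold g
    fun_prop
  have hg0 : δ ≤ g 0 := by
    have e : g 0 = ((((p : ℝ) ^ 3 - 1) / 2 - p) * κ * μ - (2 * (p : ℝ) ^ 3 - p - 1) * ν) / ((p : ℝ) ^ 3 - p) := by
      simp only [g, sub_zero, add_zero, mul_assoc]
    rw [e]; exact hδ
  have hb : 0 < min (min (1 / 2 : ℝ) (κ / 2)) ((((p : ℝ) ^ 3 - 1) / 2 - p) / 2) :=
    lt_min (lt_min (by norm_num) (by linarith)) (by linarith)
  obtain ⟨θ, hθ, hθb, hθg⟩ := exists_small_param hg hε hb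
  have hθ2 : θ ≤ 1 / 2 := le_trans hθb (le_trans (min_le_left _ _) (min_le_left _ _))
  have hθk : θ ≤ κ / 2 := le_trans hθb (le_trans (min_le_left _ _) (min_le_right _ _))
  have hθc : θ ≤ (((p : ℝ) ^ 3 - 1) / 2 - p) / 2 := le_trans hθb (min_le_right _ _)
  have hk : 0 ≤ κ - θ := by linarith
  have hc₀ : 0 ≤ (((p : ℝ) ^ 3 - 1) / 2 - p) - θ := by linarith
  filter_upwards [h13 θ hθ, hd.hC θ hθ, hd.hκ θ hθ, hd.hν θ hθ] with X h1 h2 h3 h4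
  have hcnt := cell_rank_one_count hp d hR1 X h1
  set N : ℝ := (((heightFamilyBelow X).card : ℕ) : ℝ)
  set NC : ℝ := ((((heightFamilyBelow X).filter d.C).card : ℕ) : ℝ)
  set NU : ℝ := ((((heightFamilyBelow X).filter d.U).card : ℕ) : ℝ)
  set NE : ℝ := ((((heightFamilyBelow X).filter (fun AB ↦ d.C AB ∧ ¬ d.G AB)).card : ℕ) : ℝ)
  set B : ℝ := ((((heightFamilyBelow X).filter (fun AB ↦ BSDRankLeOne inv AB ∧ d.C AB)).card : ℕ) : ℝ)
  have hN : 0 ≤ N := Nat.cast_nonneg _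
  have eU : (κ - θ) * ((μ - θ) * N) ≤ NU := le_trans (mul_le_mul_of_nonneg_left h2 hk) h3
  have e1 : ((((p : ℝ) ^ 3 - 1) / 2 - p) - θ) * ((κ - θ) * ((μ - θ) * N)) ≤ ((((p : ℝ) ^ 3 - 1) / 2 - p) - θ) * NU :=
    mul_le_mul_of_nonneg_left eU hc₀
  have e3 : (2 * (p : ℝ) ^ 3 - p - 1) * NE ≤ (2 * (p : ℝ) ^ 3 - p - 1) * ((ν + θ) * N) := mul_le_mul_of_nonneg_left h4 hc'
  have hmain : ((p : ℝ) ^ 3 - p) * (g θ * N) ≤ ((p : ℝ) ^ 3 - p) * B := by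
    have eg : ((p : ℝ) ^ 3 - p) * (g θ * N)
        = ((((((p : ℝ) ^ 3 - 1) / 2 - p) - θ) * ((κ - θ) * (μ - θ)) - (2 * (p : ℝ) ^ 3 - p - 1) * (ν + θ))) * N := by
      simp only [g]
      rw [div_mul_eq_mul_div, mul_div_assoc', mul_div_cancel_left₀ _ hq.ne']
    rw [eg]
    calc ((((((p : ℝ) ^ 3 - 1) / 2 - p) - θ) * ((κ - θ) * (μ - θ)) - (2 * (p : ℝ) ^ 3 - p - 1) * (ν + θ))) * N
        = ((((p : ℝ) ^ 3 - 1) / 2 - p) - θ) * ((κ - θ) * ((μ - θ) * N)) - (2 * (p : ℝ) ^ 3 - p - 1) * ((ν + θ) * N) := by ring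
      _ ≤ ((((p : ℝ) ^ 3 - 1) / 2 - p) - θ) * NU - (2 * (p : ℝ) ^ 3 - p - 1) * NE := by linarith [e1, e3]
      _ = ((((p : ℝ) ^ 3 - 1) / 2 - p) - θ) * NU - ((p : ℝ) ^ 3 - 1) * NE - ((p : ℝ) ^ 3 - p) * NE := by ring
      _ ≤ ((p : ℝ) ^ 3 - p) * B := hcnt
  have hB : g θ * N ≤ B := le_of_mul_le_mul_left hmain hq
  have : (δ - ε) * N ≤ g θ * N := mul_le_mul_of_nonneg_right (by linarith) hN
  linarith

end Cells

end Literature.NumberTheory.EllipticCurves.BhargavaSkinnerZhang2014
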